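import Summits.ResolutionOfSingularities.ResolutionOfSingularities.Theorems.PurelyInseparableDim4ResConeLevelTwoLegality
import HarnessLib
import HarnessLib.Audit.Tags

/-!
# Purely inseparable four-folds — LEVEL-2 LEGALITY, part 2: `σ(w) = 0` at a legal self-chart step and the
# MINOR KILL at the child (K2(p) lane, slice B, memo v1.4 §9 (K23 (ii), (iv)); cell `res-dim4-pi`)

[OURS · counted 0 · cell `res-dim4-pi` · K2(p) lane holder res-dim4-p-12 g3's brick (K23) by signature (bus
2026-08-29 00:34Z; K7 route A∞(T) = K22 + K23 + FT), seat res-dim4-p-3 g3.]  Pure algebra; nothing here proves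
K2(p), `NoIsolatedTrap p p` or resolution of singularities in dimension ≥ 4 / characteristic `p`.  AI kernel work,
weaker than expert review.

The inputs are res-dim4-p-9 g3's K22 outputs, taken BY VALUE (no import): after the self-chart step in chart
`x_j = x_λ` of a triple-merged state, `T₀u·G′ = S′·(x_j x_μ x_ν) + (U·T₀T)·(T₁h)^d` with
`S′ − U·P ∈ (x_j x_μ x_ν)` (`levelTwo_transport_triple`, `P = T_{d−2}(shear S)`, `= T₁(shear S)` at `d = 3`) and the
RESET `P − (C σ(w) + Σ_{i ≠ j} C σ_i x_i) ∈ (x_j)` (`chartTransform_one_shear_sub_linear_mem_span_X`, `σ = lin S`,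
`σ(w) = σ_j + Σ_{i ≠ j} σ_i b_i`), the same reset for `h` (`lin h = κ·ℓ`, `ℓ(w) = 0`).
* §1 **`legality_sigma_direction_eq_zero`** — if moreover the CHILD is again a triple-merged power-cone state, so
  that part 1's `levelTwo_seed_triple` gives `S′(0) = 0`, then `σ(w) = 0` (constant terms: `S′(0) = U(0)·P(0)`,
  `P(0) = σ(w)`, `U(0) ≠ 0`).
* §2 **`not_isIsolated_child_of_minor_eq_zero`** — with the four letters `j, μ, ν, v` distinct, `σ(w) = 0`,
  `ℓ(w) = 0`, `κ ≠ 0`, `ℓ_v ≠ 0` and the MINOR `m_μ = σ_μ ℓ_v − σ_v ℓ_μ = 0`: modulo `(x_j, x_ν)` both `S′` and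
  `T₁h` are multiples of `ℓ_μ x_μ + ℓ_v x_v`, so `S′ ∈ (x_j, x_ν, T₁h)` and part 1's
  `IsolatedBand.not_isIsolated_of_cofactor_mem_span_triple'` makes the child `x^{r′}·G′` NON-isolated for
  `q ≤ r′_j + r′_ν + 3` (idea-4: «μ-step illegal unless m_μ ≠ 0»; p = 5: `1 + 1 + 3`).
bears_on: LADDER-RESOLUTION:D157-DOOR2 (res-dim4-pi · K2(p) · slice B · K23).  Supports
stmt-ResolutionOfSingularities-16155 (helper).
-/

set_option linter.dupNamespace false -- mandated namespace of this single-conjunct summit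

noncomputable section

namespace Summit.ResolutionOfSingularities.ResolutionOfSingularities.Theorems.PIDim4

open MvPolynomial Finset
open Literature.AlgebraicGeometry.Resolution

variable {K : Type} [Field K]

namespace ResCone

/-! ## 1. Legality: `σ(w) = 0` -/

/-- A multiple of `x_j` (or of `x_j x_μ x_ν`) vanishes at the origin. [folklore] -/
theorem eval_zero_eq_zero_of_mem_span_X_mul {j : Fin 4} {M P : MvPolynomial (Fin 4) K}
    (hP : P ∈ Ideal.span {(X j * M : MvPolynomial (Fin 4) K)}) : MvPolynomial.eval 0 P = 0 := by
  obtain ⟨c, rfl⟩ := Ideal.mem_span_singleton.mp hP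
  rw [map_mul, map_mul, MvPolynomial.eval_X, Pi.zero_apply, zero_mul, zero_mul]

/-- The linear shadow `Σ_{i ≠ j} C σ_i x_i` vanishes at the origin. [folklore] -/
theorem eval_zero_sum_erase_C_mul_X (j : Fin 4) (σ : Fin 4 → K) :
    MvPolynomial.eval 0 (∑ i ∈ Finset.univ.erase j, C (σ i) * (X i : MvPolynomial (Fin 4) K)) = 0 := by
  rw [map_sum]
  exact Finset.sum_eq_zero fun i _ => by rw [map_mul, MvPolynomial.eval_X, Pi.zero_apply, mul_zero]

/-- **LEGALITY OF A SELF-CHART STEP: `σ(w) = 0`** (memo (K23 (ii))).  If the transported cofactor satisfies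
`S′ − U·P ∈ (x_j x_μ x_ν)` (K22 (ii)), the reset `P − (C σ_w + Σ_{i ≠ j} C σ_i x_i) ∈ (x_j)` (K22 (iii)), the lost
units have `U(0) ≠ 0`, and the child's cofactor vanishes at the origin (`S′(0) = 0`, part 1 at the child), then
`σ_w = 0` — stated for the reset's `σ_w = σ_j(S) + Σ_i σ_i(S)·b_i·[i ≠ j]` verbatim. [OURS] [folklore] -/
theorem legality_sigma_direction_eq_zero {j μ ν : Fin 4} {b : Fin 4 → K} {S S' U P : MvPolynomial (Fin 4) K}
    (hrel : S' - U * P ∈ Ideal.span {(X j * X μ * X ν : MvPolynomial (Fin 4) K)})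
    (hreset : P - (C (coeff (Finsupp.single j 1) S +
        ∑ i, coeff (Finsupp.single i 1) S * b i * (if i = j then 0 else 1)) +
        ∑ i ∈ Finset.univ.erase j, C (coeff (Finsupp.single i 1) S) * X i) ∈
      Ideal.span {(X j : MvPolynomial (Fin 4) K)})
    (hU : MvPolynomial.eval 0 U ≠ 0) (hS' : MvPolynomial.eval 0 S' = 0) :
    coeff (Finsupp.single j 1) S + ∑ i, coeff (Finsupp.single i 1) S * b i * (if i = j then 0 else 1) = 0 := by
  have h1 : MvPolynomial.eval 0 (S' - U * P) = 0 := by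
    refine eval_zero_eq_zero_of_mem_span_X_mul (j := j) (M := X μ * X ν) ?_
    rwa [← mul_assoc]
  have h2 : MvPolynomial.eval 0 (P - (C (coeff (Finsupp.single j 1) S +
      ∑ i, coeff (Finsupp.single i 1) S * b i * (if i = j then 0 else 1)) +
      ∑ i ∈ Finset.univ.erase j, C (coeff (Finsupp.single i 1) S) * X i)) = 0 := by
    refine eval_zero_eq_zero_of_mem_span_X_mul (j := j) (M := 1) ?_
    rwa [mul_one]
  rw [map_sub, map_mul, hS', zero_sub, neg_eq_zero, mul_eq_zero] at h1
  rw [map_sub, map_add, eval_zero_sum_erase_C_mul_X, add_zero, MvPolynomial.eval_C, h1.resolve_left hU,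
    zero_sub, neg_eq_zero] at h2
  exact h2

/-! ## 2. The minor kill at the child -/

/-- With four pairwise distinct letters, `univ ∖ {j} = {μ, ν, v}`. [folklore] -/
theorem univ_erase_eq_of_distinct {j μ ν v : Fin 4} (hjμ : j ≠ μ) (hjν : j ≠ ν) (hjv : j ≠ v) (hμν : μ ≠ ν)
    (hμv : μ ≠ v) (hνv : ν ≠ v) : Finset.univ.erase j = ({μ, ν, v} : Finset (Fin 4)) := by
  symm
  apply Finset.eq_of_subset_of_card_le
  · intro i hi
    simp only [Finset.mem_insert, Finset.mem_singleton] at hi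
    rw [Finset.mem_erase]
    rcases hi with rfl | rfl | rfl
    · exact ⟨hjμ.symm, Finset.mem_univ _⟩
    · exact ⟨hjν.symm, Finset.mem_univ _⟩
    · exact ⟨hjv.symm, Finset.mem_univ _⟩
  · rw [Finset.card_erase_of_mem (Finset.mem_univ j), Finset.card_univ, Fintype.card_fin,
      Finset.card_insert_of_notMem (by simp [hμν, hμv]), Finset.card_insert_of_notMem (by simp [hνv]),
      Finset.card_singleton]

/-- **THE MINOR KILL AT THE CHILD** (memo (K23 (iv)); idea-4: «after a λ-step a μ-step is ILLEGAL unless the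
minor `m_μ ≠ 0`»).  Letters `j` (chart = re-created ledger letter), `μ, ν` (kept ledger letters), `v` (the free
letter carrying the form, `ℓ_v ≠ 0`), pairwise distinct.  At the child: the triple ledger
`u′·G′ = S′·(x_j x_μ x_ν) + T′·h′^d` (`u′(0) ≠ 0`, `h′ ∈ 𝔪₀`, `d ≥ 3`), the transported cofactor
`S′ − U·P ∈ (x_j x_μ x_ν)` with reset `P ≡ C σ_w + Σ_{i ≠ j} C σ_i x_i (mod x_j)` and `σ_w = 0` (legality), the reset
of the contact polynomial `h′ ≡ C h_w + Σ_{i ≠ j} C (κ ℓ_i) x_i (mod x_j)` with `h_w = 0` (`ℓ(w) = 0`) and `κ ≠ 0`;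
if the MINOR `σ_μ ℓ_v − σ_v ℓ_μ` vanishes then `S′ ∈ (x_j, x_ν, h′)` and `x^{r′}·G′` is NOT an isolated `q`-fold point
for `q ≤ r′_j + r′_ν + 3`. [OURS] [folklore] -/
theorem not_isIsolated_child_of_minor_eq_zero {q d : ℕ} {j μ ν v : Fin 4} (hjμ : j ≠ μ) (hjν : j ≠ ν) (hjv : j ≠ v)
    (hμν : μ ≠ ν) (hμv : μ ≠ v) (hνv : ν ≠ v) {G' h' u' S' T' U P : MvPolynomial (Fin 4) K}
    (hu' : MvPolynomial.eval (0 : Fin 4 → K) u' ≠ 0) (hh' : h' ∈ originIdeal K) (hd : 3 ≤ d)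
    (hG' : u' * G' = S' * (X j * X μ * X ν) + T' * h' ^ d)
    (hrel : S' - U * P ∈ Ideal.span {(X j * X μ * X ν : MvPolynomial (Fin 4) K)})
    {σ ℓ : Fin 4 → K} {σw hw κ : K}
    (hresetS : P - (C σw + ∑ i ∈ Finset.univ.erase j, C (σ i) * X i) ∈ Ideal.span {(X j : MvPolynomial (Fin 4) K)})
    (hσw : σw = 0)
    (hreseth : h' - (C hw + ∑ i ∈ Finset.univ.erase j, C (κ * ℓ i) * X i) ∈
      Ideal.span {(X j : MvPolynomial (Fin 4) K)})
    (hhw : hw = 0) (hκ : κ ≠ 0) (hℓv : ℓ v ≠ 0) (hminor : σ μ * ℓ v - σ v * ℓ μ = 0) (r' : Fin 4 →₀ ℕ)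
    (hq : q ≤ r' j + r' ν + 3) : ¬ IsIsolated q (monomial r' 1 * G') := by
  set J : Ideal (MvPolynomial (Fin 4) K) := Ideal.span {(X j : MvPolynomial (Fin 4) K), X ν, h'} with hJ
  have hXj : (X j : MvPolynomial (Fin 4) K) ∈ J := Ideal.subset_span (by simp)
  have hXν : (X ν : MvPolynomial (Fin 4) K) ∈ J := Ideal.subset_span (by simp)
  have hh'J : h' ∈ J := Ideal.subset_span (by simp)
  have hspanj : Ideal.span {(X j : MvPolynomial (Fin 4) K)} ≤ J :=
    Ideal.span_mono (Set.singleton_subset_iff.mpr (Set.mem_insert _ _))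
  -- the two linear shadows, on the three letters `μ, ν, v`
  have hsumσ : ∑ i ∈ Finset.univ.erase j, C (σ i) * (X i : MvPolynomial (Fin 4) K) =
      C (σ μ) * X μ + C (σ ν) * X ν + C (σ v) * X v := by
    rw [univ_erase_eq_of_distinct hjμ hjν hjv hμν hμv hνv, Finset.sum_insert (by simp [hμν, hμv]),
      Finset.sum_insert (by simp [hνv]), Finset.sum_singleton, add_assoc]
  have hsumℓ : ∑ i ∈ Finset.univ.erase j, C (κ * ℓ i) * (X i : MvPolynomial (Fin 4) K) =
      C κ * (C (ℓ μ) * X μ + C (ℓ ν) * X ν + C (ℓ v) * X v) := by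
    rw [univ_erase_eq_of_distinct hjμ hjν hjv hμν hμv hνv, Finset.sum_insert (by simp [hμν, hμv]),
      Finset.sum_insert (by simp [hνv]), Finset.sum_singleton]
    simp only [map_mul]
    ring
  -- `ℓ_μ x_μ + ℓ_v x_v ∈ J`
  have hLh : C κ * (C (ℓ μ) * X μ + C (ℓ ν) * X ν + C (ℓ v) * X v) ∈ J := by
    have h1 : h' - (h' - (C hw + ∑ i ∈ Finset.univ.erase j, C (κ * ℓ i) * X i)) ∈ J :=
      Ideal.sub_mem _ hh'J (hspanj hreseth)
    rwa [sub_sub_cancel, hhw, C_0, zero_add, hsumℓ] at h1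
  have hℓμv : C (ℓ μ) * X μ + C (ℓ v) * (X v : MvPolynomial (Fin 4) K) ∈ J := by
    have h1 : C κ⁻¹ * (C κ * (C (ℓ μ) * X μ + C (ℓ ν) * X ν + C (ℓ v) * X v)) - C (ℓ ν) * X ν ∈ J :=
      Ideal.sub_mem _ (Ideal.mul_mem_left _ _ hLh) (Ideal.mul_mem_left _ _ hXν)
    have h2 : C κ⁻¹ * (C κ * (C (ℓ μ) * X μ + C (ℓ ν) * X ν + C (ℓ v) * (X v : MvPolynomial (Fin 4) K))) -
        C (ℓ ν) * X ν = C (ℓ μ) * X μ + C (ℓ v) * X v := by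
      rw [← mul_assoc, ← C_mul, inv_mul_cancel₀ hκ, C_1, one_mul]; ring
    rwa [h2] at h1
  -- `σ_μ x_μ + σ_v x_v = (σ_v/ℓ_v) · (ℓ_μ x_μ + ℓ_v x_v)` by the vanishing minor
  have hσμv : C (σ μ) * X μ + C (σ v) * (X v : MvPolynomial (Fin 4) K) =
      C (σ v * (ℓ v)⁻¹) * (C (ℓ μ) * X μ + C (ℓ v) * X v) := by
    have hσμ : σ μ = σ v * (ℓ v)⁻¹ * ℓ μ := by
      field_simp
      linear_combination hminor
    rw [mul_add, ← mul_assoc, ← mul_assoc, ← C_mul, ← C_mul, inv_mul_cancel_right₀ hℓv, ← hσμ]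
  -- hence `S′ ∈ J`
  have hS'J : S' ∈ J := by
    have h1 : S' = (S' - U * P) + U * (P - (C σw + ∑ i ∈ Finset.univ.erase j, C (σ i) * X i)) +
        U * (C σw + ∑ i ∈ Finset.univ.erase j, C (σ i) * X i) := by ring
    rw [h1]
    refine Ideal.add_mem _ (Ideal.add_mem _ ?_ (Ideal.mul_mem_left _ _ (hspanj hresetS)))
      (Ideal.mul_mem_left _ _ ?_)
    · refine hspanj (Ideal.mem_span_singleton.mpr ?_)
      obtain ⟨c, hc⟩ := Ideal.mem_span_singleton.mp hrel
      exact ⟨X μ * X ν * c, by rw [hc]; ring⟩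
    · rw [hσw, C_0, zero_add, hsumσ, add_right_comm, hσμv]
      exact Ideal.add_mem _ (Ideal.mul_mem_left _ _ hℓμv) (Ideal.mul_mem_left _ _ hXν)
  -- the ledger in the order `(x_j, x_ν, x_μ)` and part 1
  have hG'' : u' * G' = S' * (X j * X ν * X μ) + T' * h' ^ d := by rw [hG']; ring
  exact IsolatedBand.not_isIsolated_of_cofactor_mem_span_triple' hjν hh' hu' hG'' hd hS'J r' hq

end ResCone

end Summit.ResolutionOfSingularities.ResolutionOfSingularities.Theorems.PIDim4

end
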